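import Summits.Parity.GeneralizedHardyLittlewood.Theorems.LeeYangFibresAbsoluteUpgradeDipDefs
import Summits.Parity.GeneralizedHardyLittlewood.Theorems.LeeYangFibresModelCellFactsDensityBounds
import Summits.Parity.GeneralizedHardyLittlewood.Theorems.LeeYangFibresModelHyperbolicityCalculus
import HarnessLib

/-!
# Route `LeeYangFibres`, crux `AbsoluteUpgrade` (stmt-Parity-14116), line `dip-margin-rate-exchange`:
# the model pencil and the coefficient perturbation (helpers for the stub `stub_pencilDiscOfChain`)

Helper file for the registered stub `stub_pencilDiscOfChain : PencilChainZero → ModGammaDisc → MarginPoly`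
(file `LeeYangFibresAbsoluteUpgradePencilDisc.lean`).  Parity-free complex/real algebra about the MODEL ROW
`M(z) = e^{-γz}(u-1)^z/Γ(1+z) = e^{Λz}/Γ(1+z)`, `Λ := log(u-1) - γ`, and the MODEL PENCIL in product form
`f(z) = e^{-Λz}(e^{2Λz}Γ(1-z) - τΓ(1+z))/(Γ(1+z)Γ(1-z))` (`τ = -θ`), which is the additive pencil
`M(z) - τM(-z)` wherever `Γ(1±z) ≠ 0`:

* `pencilDisc_model_eq` (registered helper) — `e^{-γz}(u-1)^z = e^{Λz}`; `pencilDisc_norm_cpow` —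
  `‖(u-1)^z‖ = e^{Re z · log(u-1)}`;
* `pencilDisc_pencil_eq` — product form = additive form; `pencilDisc_sphere_lower` — the clearance
  `|τ|/5 · ‖Γ(1+z)‖ ≤ ‖τΓ(1+z) - e^{2Λz}Γ(1-z)‖` and `‖Γ(1-z)‖ ≤ C` give
  `‖f(z)‖ ≥ |τ|e^{-Λ Re z}/(5C)`;
* `pencilDisc_chain_size` — the chain equation `e^{2Λζ}Γ(1-ζ) = τΓ(1+ζ)` with `C⁻¹ ≤ ‖Γ(1∓ζ)‖ ≤ C` gives
  `C⁻²|τ| ≤ e^{2Λ Re ζ} ≤ C²|τ|`;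
* `pencilDisc_tilt_sum`, `pencilDisc_row_le_exp`, `pencilDisc_coeff_bound`, `pencilDisc_geom_le` — the
  tilted row `F(z) + θF(-z) = Σ (1 + θ(-1)^j) I_{j+1}(u) z^j`, the bound `Σ I_{j+1}(u) R^j ≤ e^{R log u}`
  (from `I_{j+1}(u) ≤ (log u)^j/j!`, tree `cellDensity_le_pow_div_factorial`), and the coefficient
  perturbation `‖Σ b_j z^j - Σ (1+θ(-1)^j) I_{j+1} z^j‖ ≤ u^{-(m+4)} e^{R log u} + u^{-u} Σ_{j<u} R^j`
  for `‖z‖ ≤ R`;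
* `pencilDisc_disc_geometry` — bookkeeping on the Rouché disc `‖z - ζ‖ ≤ 1/(4Λ)`.

No number theory and no named facts; Mathlib only (`Complex.cpow_def_of_ne_zero`, `Complex.norm_exp`,
`Real.sum_le_exp_of_nonneg`).
-/

noncomputable section

namespace Summit.Parity.GeneralizedHardyLittlewood.Cruxes.AbsoluteUpgrade.DipMarginRateExchange

open scoped BigOperators
open Summit.Parity.GeneralizedHardyLittlewood.Cruxes.ModelHyperbolicity.WindowChainTransport
open Summit.Parity.GeneralizedHardyLittlewood.Theorems.ModelCellFacts (cellDensity_le_pow_div_factorial)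

/-! ## The model row and the model pencil -/

/-- **Model identity**: `e^{-γz} (u-1)^z = e^{Λ z}` with `Λ = log(u-1) - γ` (`u ≥ 2`). -/
theorem pencilDisc_model_eq : ∀ (u : ℕ), 2 ≤ u → ∀ z : ℂ, Complex.exp (-(Real.eulerMascheroniConstant : ℂ) * z) * (((u : ℂ) - 1) ^ z) = Complex.exp (((Real.log ((u : ℝ) - 1) - Real.eulerMascheroniConstant : ℝ) : ℂ) * z) := by
  intro u hu z
  have hu1 : (0 : ℝ) < (u : ℝ) - 1 := by
    have : (2 : ℝ) ≤ u := by exact_mod_cast hu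
    linarith
  have hcast : ((u : ℂ) - 1) = (((u : ℝ) - 1 : ℝ) : ℂ) := by push_cast; ring
  have hne : ((u : ℂ) - 1) ≠ 0 := by
    rw [hcast]; exact_mod_cast hu1.ne'
  rw [Complex.cpow_def_of_ne_zero hne, ← Complex.exp_add, hcast, ← Complex.ofReal_log hu1.le]
  congr 1
  push_cast
  ring

/-- **Size of the model power**: `‖(u-1)^z‖ = exp(Re z · log(u-1))` (`u ≥ 2`). -/
theorem pencilDisc_norm_cpow (u : ℕ) (hu : 2 ≤ u) (z : ℂ) :
    ‖((u : ℂ) - 1) ^ z‖ = Real.exp (z.re * Real.log ((u : ℝ) - 1)) := by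
  have hu1 : (0 : ℝ) < (u : ℝ) - 1 := by
    have : (2 : ℝ) ≤ u := by exact_mod_cast hu
    linarith
  have hcast : ((u : ℂ) - 1) = (((u : ℝ) - 1 : ℝ) : ℂ) := by push_cast; ring
  rw [hcast, Complex.norm_cpow_eq_rpow_re_of_pos hu1, Real.rpow_def_of_pos hu1, mul_comm]

/-- **The pencil in product form equals the model pencil** where `Γ(1 ± z) ≠ 0`:
`e^{-Λz} (e^{2Λz} Γ(1-z) - τ Γ(1+z)) / (Γ(1+z) Γ(1-z)) = e^{Λz}/Γ(1+z) - τ e^{-Λz}/Γ(1-z)`. -/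
theorem pencilDisc_pencil_eq (Λ τ : ℝ) (z : ℂ) (hp : Complex.Gamma (1 + z) ≠ 0)
    (hm : Complex.Gamma (1 - z) ≠ 0) :
    Complex.exp (-((Λ : ℂ) * z)) *
        (Complex.exp (2 * (Λ : ℂ) * z) * Complex.Gamma (1 - z) -
            (τ : ℂ) * Complex.Gamma (1 + z)) /
          (Complex.Gamma (1 + z) * Complex.Gamma (1 - z)) =
      Complex.exp ((Λ : ℂ) * z) / Complex.Gamma (1 + z) -
        (τ : ℂ) * (Complex.exp (-((Λ : ℂ) * z)) / Complex.Gamma (1 - z)) := by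
  have h2 : Complex.exp (2 * (Λ : ℂ) * z) =
      Complex.exp ((Λ : ℂ) * z) * Complex.exp ((Λ : ℂ) * z) := by
    rw [← Complex.exp_add]; ring_nf
  have hinv : Complex.exp (-((Λ : ℂ) * z)) * Complex.exp ((Λ : ℂ) * z) = 1 := by
    rw [← Complex.exp_add, neg_add_cancel, Complex.exp_zero]
  rw [h2]
  field_simp
  linear_combination (Complex.exp ((Λ : ℂ) * z) * Complex.Gamma (1 - z)) * hinv

/-- **Sphere lower bound for the pencil**: the clearance `|τ|/5 · ‖Γ(1+z)‖ ≤ ‖τΓ(1+z) - e^{2Λz}Γ(1-z)‖`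
and `‖Γ(1-z)‖ ≤ C`, `Γ(1+z) ≠ 0` give `|τ| e^{-Λ Re z}/(5C) ≤ ‖pencil(z)‖`. -/
theorem pencilDisc_sphere_lower (Λ τ C : ℝ) (z : ℂ) (hC : 0 < C)
    (hp : 0 < ‖Complex.Gamma (1 + z)‖) (hmC : ‖Complex.Gamma (1 - z)‖ ≤ C)
    (hm : 0 < ‖Complex.Gamma (1 - z)‖)
    (hclear : |τ| / 5 * ‖Complex.Gamma (1 + z)‖ ≤
      ‖(τ : ℂ) * Complex.Gamma (1 + z) -
        Complex.exp (2 * (Λ : ℂ) * z) * Complex.Gamma (1 - z)‖) :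
    |τ| / (5 * C) * Real.exp (-(Λ * z.re)) ≤
      ‖Complex.exp (-((Λ : ℂ) * z)) *
        (Complex.exp (2 * (Λ : ℂ) * z) * Complex.Gamma (1 - z) -
            (τ : ℂ) * Complex.Gamma (1 + z)) /
          (Complex.Gamma (1 + z) * Complex.Gamma (1 - z))‖ := by
  rw [norm_div, norm_mul, norm_mul, Complex.norm_exp, norm_sub_rev]
  have hre : (-((Λ : ℂ) * z)).re = -(Λ * z.re) := by simp
  rw [hre]
  set N := ‖(τ : ℂ) * Complex.Gamma (1 + z) -
    Complex.exp (2 * (Λ : ℂ) * z) * Complex.Gamma (1 - z)‖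
  set P := ‖Complex.Gamma (1 + z)‖
  set M := ‖Complex.Gamma (1 - z)‖
  have hE : 0 < Real.exp (-(Λ * z.re)) := Real.exp_pos _
  rw [le_div_iff₀ (mul_pos hp hm)]
  calc |τ| / (5 * C) * Real.exp (-(Λ * z.re)) * (P * M)
      = Real.exp (-(Λ * z.re)) * (|τ| / 5 * P) * (M / C) := by
        field_simp
    _ ≤ Real.exp (-(Λ * z.re)) * N * 1 := by
        refine mul_le_mul (mul_le_mul_of_nonneg_left hclear hE.le) ((div_le_one hC).2 hmC)
          (div_nonneg hm.le hC.le) (mul_nonneg hE.le (norm_nonneg _))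
    _ = Real.exp (-(Λ * z.re)) * N := mul_one _

/-- **Size relations from the chain equation** `e^{2Λζ}Γ(1-ζ) = τΓ(1+ζ)` and the Gamma bounds
`C⁻¹ ≤ ‖Γ(1∓ζ)‖ ≤ C`: `e^{2Λ Re ζ} ≤ C² |τ|` and `|τ| ≤ C² e^{2Λ Re ζ}`. -/
theorem pencilDisc_chain_size (Λ τ C : ℝ) (ζ : ℂ) (hC : 0 < C)
    (hchain :
      Complex.exp (2 * (Λ : ℂ) * ζ) * Complex.Gamma (1 - ζ) = (τ : ℂ) * Complex.Gamma (1 + ζ))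
    (hm : C⁻¹ ≤ ‖Complex.Gamma (1 - ζ)‖) (hmC : ‖Complex.Gamma (1 - ζ)‖ ≤ C)
    (hp : C⁻¹ ≤ ‖Complex.Gamma (1 + ζ)‖) (hpC : ‖Complex.Gamma (1 + ζ)‖ ≤ C) :
    Real.exp (2 * Λ * ζ.re) ≤ C ^ 2 * |τ| ∧ |τ| ≤ C ^ 2 * Real.exp (2 * Λ * ζ.re) := by
  have hn := congrArg (fun w : ℂ => ‖w‖) hchain
  simp only [norm_mul, Complex.norm_exp, Complex.norm_real, Real.norm_eq_abs] at hn
  have hre : (2 * (Λ : ℂ) * ζ).re = 2 * Λ * ζ.re := by simp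
  rw [hre] at hn
  set E := Real.exp (2 * Λ * ζ.re) with hE
  have hEpos : 0 < E := Real.exp_pos _
  have hCi : 0 < C⁻¹ := inv_pos.2 hC
  have hCC : C⁻¹ * C = 1 := inv_mul_cancel₀ hC.ne'
  constructor
  · -- `E C⁻¹ ≤ E ‖Γ(1-ζ)‖ = |τ| ‖Γ(1+ζ)‖ ≤ |τ| C`
    have h1 : E * C⁻¹ ≤ |τ| * C := by
      calc E * C⁻¹ ≤ E * ‖Complex.Gamma (1 - ζ)‖ := mul_le_mul_of_nonneg_left hm hEpos.le
        _ = |τ| * ‖Complex.Gamma (1 + ζ)‖ := hn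
        _ ≤ |τ| * C := mul_le_mul_of_nonneg_left hpC (abs_nonneg _)
    have h2 := mul_le_mul_of_nonneg_right h1 hC.le
    calc E = E * C⁻¹ * C := by rw [mul_assoc, hCC, mul_one]
      _ ≤ |τ| * C * C := h2
      _ = C ^ 2 * |τ| := by ring
  · have h1 : |τ| * C⁻¹ ≤ E * C := by
      calc |τ| * C⁻¹ ≤ |τ| * ‖Complex.Gamma (1 + ζ)‖ :=
            mul_le_mul_of_nonneg_left hp (abs_nonneg _)
        _ = E * ‖Complex.Gamma (1 - ζ)‖ := hn.symm
        _ ≤ E * C := mul_le_mul_of_nonneg_left hmC hEpos.le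
    have h2 := mul_le_mul_of_nonneg_right h1 hC.le
    calc |τ| = |τ| * C⁻¹ * C := by rw [mul_assoc, hCC, mul_one]
      _ ≤ E * C * C := h2
      _ = C ^ 2 * E := by ring

/-! ## The row polynomial and its coefficient perturbation -/

/-- **The tilted row**: `F(z) + θ F(-z) = Σ_{j<u} (1 + θ(-1)^j) I_{j+1}(u) z^j`. -/
theorem pencilDisc_tilt_sum (u : ℕ) (θ : ℝ) (z : ℂ) :
    (∑ j ∈ Finset.range u, (cellDensity j u : ℂ) * z ^ j) +
        (θ : ℂ) * ∑ j ∈ Finset.range u, (cellDensity j u : ℂ) * (-z) ^ j =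
      ∑ j ∈ Finset.range u, (((1 + θ * (-1) ^ j) * cellDensity j u : ℝ) : ℂ) * z ^ j := by
  rw [Finset.mul_sum, ← Finset.sum_add_distrib]
  refine Finset.sum_congr rfl fun j _ => ?_
  push_cast
  rw [neg_pow]
  ring

/-- **Weighted row sum against the exponential**: `Σ_{j<u} I_{j+1}(u) R^j ≤ exp(R log u)` for `R ≥ 0`, `u ≥ 1`
(from `I_{j+1}(u) ≤ (log u)^j/j!` and the partial sums of the exponential series). -/
theorem pencilDisc_row_le_exp (u : ℕ) (hu : 1 ≤ u) {R : ℝ} (hR : 0 ≤ R) :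
    ∑ j ∈ Finset.range u, cellDensity j u * R ^ j ≤ Real.exp (R * Real.log u) := by
  have hu1 : (1 : ℝ) ≤ u := by exact_mod_cast hu
  have hlog : 0 ≤ Real.log u := Real.log_nonneg hu1
  calc ∑ j ∈ Finset.range u, cellDensity j u * R ^ j
      ≤ ∑ j ∈ Finset.range u, (R * Real.log u) ^ j / j.factorial := by
        refine Finset.sum_le_sum fun j _ => ?_
        have h1 := cellDensity_le_pow_div_factorial j u hu1
        calc cellDensity j u * R ^ j ≤ Real.log u ^ j / j.factorial * R ^ j :=
              mul_le_mul_of_nonneg_right h1 (pow_nonneg hR _)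
          _ = (R * Real.log u) ^ j / j.factorial := by rw [mul_pow]; ring
    _ ≤ Real.exp (R * Real.log u) := Real.sum_le_exp_of_nonneg (mul_nonneg hR hlog) u

/-- **Coefficient perturbation bound**: if `|b_j - (1 + θ(-1)^j) I_{j+1}(u)| ≤ u^{-(m+4)} I_{j+1}(u) + u^{-u}`
for `j < u`, then for `‖z‖ ≤ R`,
`‖Σ b_j z^j - Σ (1 + θ(-1)^j) I_{j+1}(u) z^j‖ ≤ u^{-(m+4)} exp(R log u) + u^{-u} Σ_{j<u} R^j`. -/
theorem pencilDisc_coeff_bound (u m : ℕ) (hu : 1 ≤ u) (θ : ℝ) (b : ℕ → ℝ)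
    (hb : ∀ j : ℕ, j < u →
      |b j - (1 + θ * (-1) ^ j) * cellDensity j u| ≤
        ((u : ℝ) ^ (m + 4))⁻¹ * cellDensity j u + ((u : ℝ) ^ u)⁻¹)
    (z : ℂ) {R : ℝ} (hR : ‖z‖ ≤ R) :
    ‖(∑ j ∈ Finset.range u, (b j : ℂ) * z ^ j) -
        ∑ j ∈ Finset.range u,
          (((1 + θ * (-1) ^ j) * cellDensity j u : ℝ) : ℂ) * z ^ j‖ ≤
      ((u : ℝ) ^ (m + 4))⁻¹ * Real.exp (R * Real.log u) +
        ((u : ℝ) ^ u)⁻¹ * ∑ j ∈ Finset.range u, R ^ j := by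
  have hR0 : 0 ≤ R := (norm_nonneg z).trans hR
  have hu0 : (0 : ℝ) ≤ u := Nat.cast_nonneg u
  rw [← Finset.sum_sub_distrib]
  calc ‖∑ j ∈ Finset.range u,
          ((b j : ℂ) * z ^ j - (((1 + θ * (-1) ^ j) * cellDensity j u : ℝ) : ℂ) * z ^ j)‖
      ≤ ∑ j ∈ Finset.range u,
          ‖(b j : ℂ) * z ^ j -
            (((1 + θ * (-1) ^ j) * cellDensity j u : ℝ) : ℂ) * z ^ j‖ :=
        norm_sum_le _ _
    _ = ∑ j ∈ Finset.range u, |b j - (1 + θ * (-1) ^ j) * cellDensity j u| * ‖z‖ ^ j := by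
        refine Finset.sum_congr rfl fun j _ => ?_
        rw [← sub_mul, norm_mul, norm_pow, ← Complex.ofReal_sub, Complex.norm_real,
          Real.norm_eq_abs]
    _ ≤ ∑ j ∈ Finset.range u,
          (((u : ℝ) ^ (m + 4))⁻¹ * cellDensity j u + ((u : ℝ) ^ u)⁻¹) * R ^ j := by
        refine Finset.sum_le_sum fun j hj => ?_
        exact mul_le_mul (hb j (Finset.mem_range.1 hj)) (pow_le_pow_left₀ (norm_nonneg _) hR j)
          (pow_nonneg (norm_nonneg _) _)
          (add_nonneg (mul_nonneg (inv_nonneg.2 (pow_nonneg hu0 _)) (calc_nonneg j _))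
            (inv_nonneg.2 (pow_nonneg hu0 _)))
    _ = ((u : ℝ) ^ (m + 4))⁻¹ * ∑ j ∈ Finset.range u, cellDensity j u * R ^ j +
          ((u : ℝ) ^ u)⁻¹ * ∑ j ∈ Finset.range u, R ^ j := by
        rw [Finset.mul_sum, Finset.mul_sum, ← Finset.sum_add_distrib]
        refine Finset.sum_congr rfl fun j _ => ?_
        ring
    _ ≤ ((u : ℝ) ^ (m + 4))⁻¹ * Real.exp (R * Real.log u) +
          ((u : ℝ) ^ u)⁻¹ * ∑ j ∈ Finset.range u, R ^ j := by
        have := pencilDisc_row_le_exp u hu hR0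
        gcongr

/-- **The floor sum**: `Σ_{j<u} R^j ≤ u · a^u` for `0 ≤ R ≤ a`, `1 ≤ a`. -/
theorem pencilDisc_geom_le (u : ℕ) {R a : ℝ} (hR : 0 ≤ R) (hRa : R ≤ a) (ha : 1 ≤ a) :
    ∑ j ∈ Finset.range u, R ^ j ≤ u * a ^ u := by
  calc ∑ j ∈ Finset.range u, R ^ j ≤ ∑ j ∈ Finset.range u, a ^ u := by
        refine Finset.sum_le_sum fun j hj => ?_
        exact (pow_le_pow_left₀ hR hRa j).trans
          (pow_le_pow_right₀ ha (Finset.mem_range.1 hj).le)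
    _ = u * a ^ u := by rw [Finset.sum_const, Finset.card_range, nsmul_eq_mul]

/-! ## Geometry of the Rouché disc -/

/-- **Geometry of the Rouché disc**: for `‖z - ζ‖ ≤ 1/(4Λ)` (`Λ ≥ 2`), `3/4 < Im ζ < 5/4`,
`|Re ζ - x| < 1/4` with `-m ≤ x ≤ log 2/(2Λ)`: the bounds on `Re z`, `‖z‖` and `Im z` used below. -/
theorem pencilDisc_disc_geometry {Λ x : ℝ} {m : ℕ} {ζ z : ℂ} (hΛ : 2 ≤ Λ)
    (hx_lo : -(m : ℝ) ≤ x) (hx_hi : x ≤ Real.log 2 / (2 * Λ))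
    (hr : |ζ.re - x| < 1 / 4) (him_lo : 3 / 4 < ζ.im) (him_hi : ζ.im < 5 / 4)
    (hz : ‖z - ζ‖ ≤ 1 / (4 * Λ)) :
    z.re ≤ ζ.re + 1 / (4 * Λ) ∧ ζ.re - 1 / (4 * Λ) ≤ z.re ∧ z.re ≤ 3 / 5 ∧
      -(m : ℝ) - 1 / 2 ≤ z.re ∧ |z.re| ≤ (m : ℝ) + 1 ∧ ‖z‖ ≤ |z.re| + 2 ∧
      ‖z‖ ≤ (m : ℝ) + 3 ∧ 1 / 2 < z.im := by
  have hΛ0 : 0 < Λ := by linarith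
  have hρ : 1 / (4 * Λ) ≤ 1 / 8 := by
    rw [div_le_div_iff₀ (by positivity) (by norm_num)]; linarith
  have hre : |z.re - ζ.re| ≤ ‖z - ζ‖ := by simpa using Complex.abs_re_le_norm (z - ζ)
  have him : |z.im - ζ.im| ≤ ‖z - ζ‖ := by simpa using Complex.abs_im_le_norm (z - ζ)
  have hl2 : Real.log 2 < 0.6931471808 := Real.log_two_lt_d9
  have hxhi' : x ≤ 0.18 := by
    refine hx_hi.trans ?_
    rw [div_le_iff₀ (by positivity)]
    nlinarith
  rw [abs_lt] at hr
  have hre' := abs_le.1 (hre.trans hz)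
  have him' := abs_le.1 (him.trans hz)
  have hm0 : (0 : ℝ) ≤ m := Nat.cast_nonneg m
  have hzre_abs : |z.re| ≤ (m : ℝ) + 1 := by
    rw [abs_le]; constructor <;> linarith
  have hzim_abs : |z.im| ≤ 2 := by
    rw [abs_le]; constructor <;> linarith
  refine ⟨by linarith [hre'.2], by linarith [hre'.1], by linarith, by linarith, hzre_abs, ?_, ?_,
    by linarith⟩
  · calc ‖z‖ ≤ |z.re| + |z.im| := Complex.norm_le_abs_re_add_abs_im z
      _ ≤ |z.re| + 2 := by linarith
  · calc ‖z‖ ≤ |z.re| + |z.im| := Complex.norm_le_abs_re_add_abs_im z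
      _ ≤ ((m : ℝ) + 1) + 2 := add_le_add hzre_abs hzim_abs
      _ = (m : ℝ) + 3 := by ring

end Summit.Parity.GeneralizedHardyLittlewood.Cruxes.AbsoluteUpgrade.DipMarginRateExchange

end
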